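import Summits.AtomisticToContinuum.BoseEinsteinCondensation.Theorems.BECHeatBathGapSomeNearMinimiserCondenses
import Summits.AtomisticToContinuum.BoseEinsteinCondensation.Theorems.BECHeatBathGapJastrowDobrushinRungModel
import Literature.MathematicalPhysics.QuantumManyBody.GroundState
import Literature.MathematicalPhysics.QuantumManyBody.BoseGasDirichletWall
import Literature.MathematicalPhysics.QuantumManyBody.SwapPurity
import Mathlib.MeasureTheory.Group.LIntegral
import HarnessLib

/-!
# Route `BECHeatBathGap`, crux `SquareSummableInfluence` (stmt-AtomisticToContinuum-14368),
# line `registered`: the rung `pairProductInsertion_norm_ge`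

Supports (does not close) stmt-AtomisticToContinuum-14368; registered stub
`pairProductInsertion_norm_ge` of line `registered` (a rung companion: the normalisation lower
bound for the pair-product insertion state).

**Statement.** For a measurable `f : ℝ³ → [0, 1]`, a measurable bath state `Θ : Λ^N → ℂ` and the
pair-product insertion state `Ψ(Z) = Θ(tail Z) · ∏ⱼ f(Z 0 − Z (succ j))` on `Λ_L^{N+1}`
(`Z 0` the inserted particle, `tail Z` the `N` bath particles):

`(L³ − N ∫_{ℝ³} (1 − f²)) · ∫_{Λ_L^N} |Θ|² ≤ ∫_{Λ_L^{N+1}} |Ψ|²`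

in `ℝ≥0∞` with truncated subtraction (trivial when `N ∫(1 − f²) ≥ L³` or `L ≤ 0`).

## Proof

Tonelli over `Λ_L × Λ_L^N ≅ Λ_L^{N+1}` (`setLIntegral_box_boxN_vecCons`) and a swap of the two
integrals give `∫_{Λ_L^{N+1}} |Ψ|² = ∫_{X ∈ Λ_L^N} |Θ X|² (∫_{y ∈ Λ_L} ∏ⱼ f(y − X j)² dy) dX`.
Pointwise `∏ⱼ f(y − X j)² ≥ 1 − ∑ⱼ (1 − f(y − X j)²)` (each factor in `[0, 1]`,
`JastrowDobrushin.one_sub_prod_le_sum`), so the inner integral is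
`≥ |Λ_L| − ∑ⱼ ∫_{Λ_L} (1 − f(y − X j)²) dy ≥ L³ − N ∫_{ℝ³} (1 − f²)` (monotonicity in the domain and
translation invariance of Lebesgue measure, `lintegral_sub_right_eq_self`). Multiply by `|Θ X|²`
and integrate over `Λ_L^N`.

No new definitions; `[folklore]`.
-/

noncomputable section

open MeasureTheory Filter
open scoped ENNReal NNReal Topology

namespace Summit.AtomisticToContinuum.BoseEinsteinCondensation.Theorems.SquareSummableInfluence

open Literature.MathematicalPhysics.QuantumManyBody.BoseGas
open Summit.AtomisticToContinuum.BoseEinsteinCondensation.Theorems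

/-! ### Bookkeeping lemmas -/

/-- The deficit estimate in `ℝ≥0∞`: for `g_j ∈ [0, 1]`,
`1 − ∑ⱼ ofReal (1 − g_j) ≤ ofReal (∏ⱼ g_j)` (from `1 − ∏ g ≤ ∑ (1 − g)`). [folklore] -/
private theorem one_sub_sum_le_ofReal_prod {N : ℕ} (g : Fin N → ℝ)
    (hg : ∀ j, 0 ≤ g j ∧ g j ≤ 1) :
    1 - ∑ j, ENNReal.ofReal (1 - g j) ≤ ENNReal.ofReal (∏ j, g j) := by
  have hreal : (1 : ℝ) ≤ ∏ j, g j + ∑ j, (1 - g j) := by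
    have h := JastrowDobrushin.one_sub_prod_le_sum Finset.univ g fun j _ => hg j
    linarith
  rw [tsub_le_iff_right]
  calc (1 : ℝ≥0∞) = ENNReal.ofReal 1 := ENNReal.ofReal_one.symm
    _ ≤ ENNReal.ofReal (∏ j, g j + ∑ j, (1 - g j)) := ENNReal.ofReal_le_ofReal hreal
    _ = ENNReal.ofReal (∏ j, g j) + ENNReal.ofReal (∑ j, (1 - g j)) :=
        ENNReal.ofReal_add (Finset.prod_nonneg fun j _ => (hg j).1)
          (Finset.sum_nonneg fun j _ => sub_nonneg.2 (hg j).2)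
    _ = ENNReal.ofReal (∏ j, g j) + ∑ j, ENNReal.ofReal (1 - g j) := by
        rw [ENNReal.ofReal_sum_of_nonneg fun j _ => sub_nonneg.2 (hg j).2]

/-- **The one-particle integral of the pair weight is almost the volume**: for measurable
`f : ℝ³ → [0, 1]` and every bath configuration `X`,
`L³ − N ∫_{ℝ³} (1 − f²) ≤ ∫_{y ∈ Λ_L} ∏ⱼ f(y − X j)² dy` (truncated subtraction in `ℝ≥0∞`;
`1 − ∏ ≤ ∑ (1 − ·)`, monotonicity in the domain, translation invariance). [folklore] -/
private theorem volume_sub_le_setLIntegral_box_prod_sq {N : ℕ} (L : ℝ) {f : Space → ℝ}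
    (hf : Measurable f) (hf01 : ∀ x, 0 ≤ f x ∧ f x ≤ 1) (X : Config N) :
    ENNReal.ofReal L ^ 3 - (N : ℝ≥0∞) * ∫⁻ x, ENNReal.ofReal (1 - f x ^ 2) ≤
      ∫⁻ y in box L, ENNReal.ofReal (∏ j : Fin N, f (y - X j) ^ 2) := by
  have hsq : ∀ x, 0 ≤ f x ^ 2 ∧ f x ^ 2 ≤ 1 := fun x =>
    ⟨sq_nonneg _, pow_le_one₀ (hf01 x).1 (hf01 x).2⟩
  have hDm : Measurable fun x : Space => ENNReal.ofReal (1 - f x ^ 2) :=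
    (measurable_const.sub (hf.pow_const 2)).ennreal_ofReal
  have hDjm : ∀ j : Fin N, Measurable fun y : Space => ENNReal.ofReal (1 - f (y - X j) ^ 2) :=
    fun j => hDm.comp (measurable_sub_const (X j))
  calc ENNReal.ofReal L ^ 3 - (N : ℝ≥0∞) * ∫⁻ x, ENNReal.ofReal (1 - f x ^ 2)
      ≤ ENNReal.ofReal L ^ 3 -
          ∫⁻ y in box L, ∑ j : Fin N, ENNReal.ofReal (1 - f (y - X j) ^ 2) := by
        refine tsub_le_tsub_left ?_ _
        calc ∫⁻ y in box L, ∑ j : Fin N, ENNReal.ofReal (1 - f (y - X j) ^ 2)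
            = ∑ j : Fin N, ∫⁻ y in box L, ENNReal.ofReal (1 - f (y - X j) ^ 2) :=
              lintegral_finsetSum _ fun j _ => hDjm j
          _ ≤ ∑ j : Fin N, ∫⁻ y, ENNReal.ofReal (1 - f (y - X j) ^ 2) :=
              Finset.sum_le_sum fun j _ => setLIntegral_le_lintegral _ _
          _ = ∑ _j : Fin N, ∫⁻ y, ENNReal.ofReal (1 - f y ^ 2) :=
              Finset.sum_congr rfl fun j _ =>
                lintegral_sub_right_eq_self (fun y => ENNReal.ofReal (1 - f y ^ 2)) (X j)
          _ = (N : ℝ≥0∞) * ∫⁻ x, ENNReal.ofReal (1 - f x ^ 2) := by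
              rw [Finset.sum_const, Finset.card_univ, Fintype.card_fin, nsmul_eq_mul]
    _ = (∫⁻ _ in box L, (1 : ℝ≥0∞)) -
          ∫⁻ y in box L, ∑ j : Fin N, ENNReal.ofReal (1 - f (y - X j) ^ 2) := by
        rw [setLIntegral_const, one_mul, volume_box]
    _ ≤ ∫⁻ y in box L, (1 - ∑ j : Fin N, ENNReal.ofReal (1 - f (y - X j) ^ 2)) :=
        lintegral_sub_le _ _ (Finset.measurable_sum _ fun j _ => hDjm j)
    _ ≤ ∫⁻ y in box L, ENNReal.ofReal (∏ j : Fin N, f (y - X j) ^ 2) :=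
        lintegral_mono fun y => one_sub_sum_le_ofReal_prod (fun j => f (y - X j) ^ 2) fun j => hsq _

/-- The pair-product insertion integrand factorises:
`|θ · ∏ⱼ rⱼ|² = |θ|² · ofReal (∏ⱼ rⱼ²)` for real `rⱼ`, in `ℝ≥0∞`. [folklore] -/
private theorem coe_nnnorm_mul_prod_ofReal_sq (θ : ℂ) {N : ℕ} (r : Fin N → ℝ) :
    (‖θ * ∏ j, (r j : ℂ)‖₊ : ℝ≥0∞) ^ 2 = (‖θ‖₊ : ℝ≥0∞) ^ 2 * ENNReal.ofReal (∏ j, r j ^ 2) := by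
  rw [nnnorm_mul, ENNReal.coe_mul, mul_pow, ← Complex.ofReal_prod, Complex.nnnorm_real,
    coe_nnnorm_sq_eq_ofReal (∏ j, r j), Real.norm_eq_abs, sq_abs, Finset.prod_pow]

/-- Swapping the order of integration over `Λ_L^N` and `Λ_L` for a jointly measurable
nonnegative integrand (Tonelli). [folklore] -/
private theorem setLIntegral_boxN_box_swap {N : ℕ} (L : ℝ) {H : Space → Config N → ℝ≥0∞}
    (hH : Measurable (Function.uncurry H)) :
    ∫⁻ X in boxN N L, ∫⁻ y in box L, H y X = ∫⁻ y in box L, ∫⁻ X in boxN N L, H y X :=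
  (lintegral_lintegral_swap hH.aemeasurable).symm

/-! ### The stub -/

/-- **Rung companion of line `registered` of the crux `SquareSummableInfluence`: normalisation of
the pair-product insertion state.** For measurable `f : ℝ³ → [0, 1]`, measurable `Θ : Λ^N → ℂ`
and `Ψ(Z) = Θ(tail Z) ∏ⱼ f(Z 0 − Z (succ j))`:
`(L³ − N ∫_{ℝ³} (1 − f²)) ∫_{Λ_L^N} |Θ|² ≤ ∫_{Λ_L^{N+1}} |Ψ|²` (in `ℝ≥0∞`, truncated subtraction).
Proof: Tonelli `Λ_L^{N+1} ≅ Λ_L × Λ_L^N`, `∏ⱼ f(y − X j)² ≥ 1 − ∑ⱼ (1 − f(y − X j)²)`,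
`∫_{Λ_L} 1 = L³`, `∫_{Λ_L} (1 − f(· − X j)²) ≤ ∫_{ℝ³} (1 − f²)`. [folklore] -/
theorem pairProductInsertion_norm_ge :
    ∀ (N : ℕ) (L : ℝ) (f : Space → ℝ) (Θ : Config N → ℂ), Measurable f → (∀ x, 0 ≤ f x ∧ f x ≤ 1) →
      Measurable Θ →
      (ENNReal.ofReal L ^ 3 - (N : ℝ≥0∞) * ∫⁻ x, ENNReal.ofReal (1 - f x ^ 2)) *
          ∫⁻ X in boxN N L, (‖Θ X‖₊ : ℝ≥0∞) ^ 2 ≤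
        ∫⁻ Z in boxN (N + 1) L,
          (‖Θ (Matrix.vecTail Z) * (∏ j : Fin N, (f (Z 0 - Z (Fin.succ j)) : ℂ))‖₊ : ℝ≥0∞) ^ 2 := by
  intro N L f Θ hf hf01 hΘ
  -- measurability bookkeeping
  have hΘ2 : Measurable fun X : Config N => (‖Θ X‖₊ : ℝ≥0∞) ^ 2 :=
    hΘ.nnnorm.coe_nnreal_ennreal.pow_const 2
  have hW : ∀ X : Config N,
      Measurable fun y : Space => ENNReal.ofReal (∏ j : Fin N, f (y - X j) ^ 2) := fun X =>
    (Finset.measurable_prod _ fun j _ =>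
      (hf.comp (measurable_sub_const (X j))).pow_const 2).ennreal_ofReal
  have hG : Measurable fun Z : Config (N + 1) =>
      (‖Θ (Matrix.vecTail Z) * (∏ j : Fin N, (f (Z 0 - Z (Fin.succ j)) : ℂ))‖₊ : ℝ≥0∞) ^ 2 := by
    exact ((hΘ.comp measurable_vecTail).mul (Finset.measurable_prod _ fun j _ =>
      Complex.measurable_ofReal.comp (hf.comp ((measurable_pi_apply 0).sub
        (measurable_pi_apply (Fin.succ j)))))).nnnorm.coe_nnreal_ennreal.pow_const 2
  have hH : Measurable (Function.uncurry fun (y : Space) (X : Config N) =>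
      (‖Θ X * ∏ j : Fin N, (f (y - X j) : ℂ)‖₊ : ℝ≥0∞) ^ 2) := by
    exact ((hΘ.comp measurable_snd).mul (Finset.measurable_prod _ fun j _ =>
      Complex.measurable_ofReal.comp (hf.comp (measurable_fst.sub
        ((measurable_pi_apply j).comp measurable_snd))))).nnnorm.coe_nnreal_ennreal.pow_const 2
  calc (ENNReal.ofReal L ^ 3 - (N : ℝ≥0∞) * ∫⁻ x, ENNReal.ofReal (1 - f x ^ 2)) *
        ∫⁻ X in boxN N L, (‖Θ X‖₊ : ℝ≥0∞) ^ 2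
      = ∫⁻ X in boxN N L, (ENNReal.ofReal L ^ 3 - (N : ℝ≥0∞) * ∫⁻ x, ENNReal.ofReal (1 - f x ^ 2)) *
          (‖Θ X‖₊ : ℝ≥0∞) ^ 2 := (lintegral_const_mul _ hΘ2).symm
    _ ≤ ∫⁻ X in boxN N L, (∫⁻ y in box L, ENNReal.ofReal (∏ j : Fin N, f (y - X j) ^ 2)) *
          (‖Θ X‖₊ : ℝ≥0∞) ^ 2 :=
        lintegral_mono fun X =>
          mul_le_mul' (volume_sub_le_setLIntegral_box_prod_sq L hf hf01 X) le_rfl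
    _ = ∫⁻ X in boxN N L, ∫⁻ y in box L,
          (‖Θ X * ∏ j : Fin N, (f (y - X j) : ℂ)‖₊ : ℝ≥0∞) ^ 2 := by
        refine lintegral_congr fun X => ?_
        rw [← lintegral_mul_const _ (hW X)]
        refine lintegral_congr fun y => ?_
        rw [coe_nnnorm_mul_prod_ofReal_sq]
        exact mul_comm _ _
    _ = ∫⁻ y in box L, ∫⁻ X in boxN N L,
          (‖Θ X * ∏ j : Fin N, (f (y - X j) : ℂ)‖₊ : ℝ≥0∞) ^ 2 := setLIntegral_boxN_box_swap L hH
    _ = ∫⁻ Z in boxN (N + 1) L,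
          (‖Θ (Matrix.vecTail Z) * (∏ j : Fin N, (f (Z 0 - Z (Fin.succ j)) : ℂ))‖₊ : ℝ≥0∞) ^ 2 := by
        rw [← setLIntegral_box_boxN_vecCons L hG]
        simp only [Matrix.tail_cons, Matrix.cons_val_zero, Matrix.cons_val_succ]

end Summit.AtomisticToContinuum.BoseEinsteinCondensation.Theorems.SquareSummableInfluence

end
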